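import Mathlib
import Summits.Ventures.HodgeRepro2.T6N1WitGram2

/-!
# T6N1WitGram3 — the Gram functional of the proportional dictionary and the monomial case of the Petersson
display (the non-degenerate N1 instance, STATUS l. 11284 (S5); owner t6-p1, gen 3)

Continues T6N1WitGram2: `λ₂ := λ₂raw ∘ (id − projL)` for the proportional dictionary `scP`
(`lam2P_pull2`: vanishes on `f^*`; `lam2P_eS`), `λ₂` on a pair product is the Gram value off the first copy
(`lam2P_prod_eS`), and with the `(★)` block of T6N1WitGram2 the monomial identity
`(λ₁ + λ₂)(e_p · conj2 e_q) = ⟪sc e_q, sc e_p⟫` holds for ALL `U`-pairs (`intS_eS_pairP`); `H10 · H10` lies in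
the span of the pair monomials (`mul_H10_le_span_pairs`). No `sorry`; standard axioms.
§8(d): uses an L-value-free non-vanishing device: NO.
-/

namespace Summit.Ventures.HodgeRepro2.T6.N1Wit

open ExteriorAlgebra Conj Set.powersetCard NumberField
open scoped InnerProductSpace

variable {K : Type} [Field K] [NumberField K] {F : FaceSetting K} (D : WitData F) (σ₀ : K →+* ℂ)

namespace WitData

/-! ## 4. The Gram functional and the monomial case of the Petersson display -/

open Classical in
/-- The raw Gram functional of `scP`. -/
noncomputable def lam2rawP : HS2 K →ₗ[ℂ] ℂ :=
  ∑ p ∈ pairs F, ∑ q ∈ pairs F,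
    if SPQ p q ⊆ Iinl K then 0
    else (⟪D.scP σ₀ (D.eS q), D.scP σ₀ (D.eS p)⟫_ℂ / D.sPQ p q) • D.coordS (SPQ p q)

/-- THE GRAM FUNCTIONAL `λ₂ := λ₂raw ∘ (id - projL)`: vanishes on the first copy by construction. -/
noncomputable def lam2P : HS2 K →ₗ[ℂ] ℂ :=
  D.lam2rawP σ₀ ∘ₗ (LinearMap.id - (projL K).toLinearMap)

/-- `λ₂` vanishes on the image of `f^*`. -/
theorem lam2P_pull2 (x : HBC K) : D.lam2P σ₀ (pull2 x) = 0 := by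
  simp only [lam2P, LinearMap.comp_apply, LinearMap.sub_apply, LinearMap.id_apply,
    AlgHom.toLinearMap_apply, projL_pull2, sub_self, map_zero]

/-- `λ₂` on monomials: `λ₂raw` off the first copy, `0` on it. -/
theorem lam2P_eS (S : Finset (Fin (nJ K))) :
    D.lam2P σ₀ (D.eS S) = if S ⊆ Iinl K then 0 else D.lam2rawP σ₀ (D.eS S) := by
  simp only [lam2P, LinearMap.comp_apply, LinearMap.sub_apply, LinearMap.id_apply,
    AlgHom.toLinearMap_apply]
  split_ifs with h
  · rw [D.projL_eS_of_subset h, sub_self, map_zero]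
  · rw [D.projL_eS_of_not_subset h, sub_zero]

/-- `λ₂` on a pair product: the Gram value when the product leaves the first copy, `0` otherwise. -/
theorem lam2P_prod_eS {p q : Finset (Fin (nJ K))} (hp : p ∈ pairs F) (hq : q ∈ pairs F) :
    D.lam2P σ₀ (D.eS p * conj2 (D.eS q)) =
      if SPQ p q ⊆ Iinl K then 0 else ⟪D.scP σ₀ (D.eS q), D.scP σ₀ (D.eS p)⟫_ℂ := by
  classical
  rw [D.prod_eS_eq_sPQ_smul hp hq, map_smul, D.lam2P_eS]
  split_ifs with hsub
  · simp
  rw [lam2rawP, LinearMap.sum_apply]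
  rw [Finset.sum_eq_single_of_mem p hp]
  · rw [LinearMap.sum_apply, Finset.sum_eq_single_of_mem q hq]
    · rw [if_neg hsub]
      have hs := D.sPQ_ne_zero hp hq
      rw [LinearMap.smul_apply, coordS_eS, if_pos rfl, smul_eq_mul, smul_eq_mul, mul_one]
      field_simp
    · intro q' hq' hne
      split_ifs with h
      · simp
      · rw [LinearMap.smul_apply, coordS_eS, if_neg, smul_zero]
        intro heq
        exact hne (SPQ_injective hp hq' hp hq heq).2
  · intro p' hp' hne
    rw [LinearMap.sum_apply]
    refine Finset.sum_eq_zero fun q' hq' => ?_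
    split_ifs with h
    · simp
    · rw [LinearMap.smul_apply, coordS_eS, if_neg, smul_zero]
      intro heq
      exact hne (SPQ_injective hp' hq' hp hq heq).1

/-- A pair product inside the first copy comes from a first-copy `p` and a second-copy `q`. -/
theorem mem_pairs1_and_pairs3_of_subset {p q : Finset (Fin (nJ K))} (hp : p ∈ pairs F)
    (hq : q ∈ pairs F) (h : SPQ p q ⊆ Iinl K) : p ∈ pairs1 F ∧ q ∈ pairs3 F := by
  classical
  refine ⟨Finset.mem_filter.2 ⟨hp, fun x hx => h (Finset.mem_union_left _ hx)⟩,
    Finset.mem_filter.2 ⟨hq, ?_⟩⟩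
  rw [Finset.disjoint_left]
  intro x hxq hxI
  have hC : Cidx K x ∈ Iinl K := h (Finset.mem_union_right _ (Finset.mem_image_of_mem _ hxq))
  exact (Cidx_mem_Iinl_iff x).1 hC hxI

/-- THE MONOMIAL CASE OF THE PETERSSON DISPLAY: `(λ₁ + λ₂)(e_p · conj2 e_q) = ⟪sc e_q, sc e_p⟫`. -/
theorem intS_eS_pairP {p q : Finset (Fin (nJ K))} (hp : p ∈ pairs F) (hq : q ∈ pairs F) :
    (lam1 (D.heK σ₀) + D.lam2P σ₀) (D.eS p * conj2 (D.eS q)) =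
      ⟪D.scP σ₀ (D.eS q), D.scP σ₀ (D.eS p)⟫_ℂ := by
  classical
  rw [LinearMap.add_apply, D.lam2P_prod_eS σ₀ hp hq]
  split_ifs with h
  · obtain ⟨hp1, hq3⟩ := mem_pairs1_and_pairs3_of_subset hp hq h
    rw [add_zero, D.inner_scP_eS σ₀ hp1 hq3]
    rfl
  · rw [D.prod_eS_eq_sPQ_smul hp hq, map_smul, D.lam1_eS_of_not_subset (D.heK σ₀) h, smul_zero,
      zero_add]

/-! ## 5. `H20 = H10 · H10` lies in the span of the pair monomials -/

/-- `H10 · H10 ≤ span {e_p : p a U-pair}`. -/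
theorem mul_H10_le_span_pairs :
    D.H10 * D.H10 ≤ Submodule.span ℂ (D.eS '' (pairs F : Set (Finset (Fin (nJ K))))) := by
  rw [H10, Submodule.span_mul_span, Submodule.span_le]
  rintro _ ⟨x, ⟨a, ha, rfl⟩, y, ⟨b, hb, rfl⟩, rfl⟩
  show ι ℂ (D.bI a) * ι ℂ (D.bI b) ∈ Submodule.span ℂ (D.eS '' (pairs F : Set (Finset (Fin (nJ K)))))
  by_cases hab : a = b
  · subst hab
    rw [ι_sq_zero]
    exact Submodule.zero_mem _
  · obtain ⟨u, hu⟩ := D.eS_mul_eS_of_disjoint (Finset.disjoint_singleton.2 hab)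
    rw [← D.eS_singleton, ← D.eS_singleton, hu, units_smul_eq]
    refine Submodule.smul_mem _ _ (Submodule.subset_span ⟨{a} ∪ {b}, ?_, rfl⟩)
    rw [Finset.mem_coe, ← Finset.insert_eq]
    exact mem_pairs.2 ⟨Finset.insert_subset ha (Finset.singleton_subset_iff.2 hb), Finset.card_pair hab⟩

end WitData

end Summit.Ventures.HodgeRepro2.T6.N1Wit
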